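import Summits.ABC.IUTFork.Repair.CandInternal40
import Summits.ABC.IUTFork.Repair.CandInternal41
import Summits.ABC.IUTFork.Repair.CandMochizuki6Separation
import Summits.ABC.IUTFork.Cor312UnitCountermodel
import Summits.ABC.IUTFork.Cor312PilotKummerNaturalWitness
import Summits.ABC.IUTFork.Cor312TwoPlacePins
import HarnessLib

/-!
# REPAIR branch B0 / CandInternal41Beds — rows RP-I16/RP-I17 on the beds of record U · P♮ · SPH · DUAL (seat abc-iut-rp-d4)

Proof-only cell file (no `Prop` fact, no new definition; hypotheses of `Repair.CandInternal40/41` evaluated BY NAME on model data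
already in the tree). It completes the PROFILE of the sub-cell-B0 rows RP-I16a `HAlienColumn`, RP-I16b `HInd3Origin`, RP-I17a
`HUnitCoric`, RP-I17b `HDegreeOrbit` ([IUTchII] Cor. 4.10 (v) «ℝ_{>0}-orbits», orbit parameter `c > 0`) and the NOT-IN-PRINT sharpening
RP-I17b′ `HDegreeOrbitGe` (`c ≥ 1`) over the B-lead's beds of record (STATUS abc-iut-rp-m3 2026-08-26T09:22Z: CM · LS · P♮ · U · FLIP ·
SPH · DUAL · REAL; CM/LS/FLIP/EXP/∀-honest/REAL cells are in `CandInternal41`, `CandInternal41Profile`, `CandInternal41Real`).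

## CELLS (axioms standard)
* **U** (abc-iut-w4-d101's unit bed `UnitWitness.uSetting p`, typed Thm. 3.11 with genuine unit indeterminacies): `negLogThetaAt = −(5/2)·log p`,
  `HDegreeOrbit` ✓ with `c = 2/5` (`hDegreeOrbit_unit`), `HDegreeOrbitGe` ✗ (`not_hDegreeOrbitGe_unit`) — same numerics as CM.
* **P♮** (abc-iut-w4-d103's natural model `natSetting`, where `S` HOLDS): `negLogThetaAt = −2 = −|log q|`, `HDegreeOrbitGe` ✓ with `c = 1`
  (`hDegreeOrbitGe_nat`), hence `HDegreeOrbit` ✓.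
* **SPH** (abc-iut-w4-d021's sphere bed `sphereSetting p`: Θ-images the sphere `S_1`, q-image `B_2`): `negLogThetaAt = −log p + log(1 − 1/p)`,
  **`HDegreeOrbitGe` ✓ for EVERY prime `p`** (`c = 2·log p / (log p − log(1 − 1/p)) ≥ 1`, `= 1` iff `p = 2`; `hDegreeOrbitGe_sphere`), while
  `S = PilotKummerIndRelated` FAILS at `p = 2` (w4-d021 `sphereSetting_not_pilotKummerIndRelated`) and the Corollary holds STRICTLY:
  **`sphere_two_profile`** — all five B0 hypotheses of this seat hold at SPH(2) together with the three pins, `BridgeHyps`, `AbsLogQPos`,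
  typed Thm. 3.11 and the Statement, and `S` fails. CENSUS FACT (kernel): **`hDegreeOrbitGe_not_imp_residual`** — the level-S supplier
  RP-I17b′ does NOT factor through the residual `S` (it is sufficient for `Statement`, `CandInternal41.statement_of_hDegreeOrbitGe`, and
  insufficient for `S`), and the conjunction of the seat's typed readings of [IUTchIII] Rmk. 3.12.2 (ii)(d_itw), (iii) and [IUTchII]
  Cor. 4.10 (iv), (v) (+ the `c ≥ 1` sharpening) does not supply `S` either.
* **DUAL** (abc-iut-rp-m2's dual sphere bed `CandMochizuki6Separation.dualSetting p`: Θ-images `B_2`, q-image `S_1`): `negLogThetaAt = −2·log p`,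
  `HDegreeOrbit` ✓ every `p` (`hDegreeOrbit_dual`), `HDegreeOrbitGe` ✓ at `p = 2` (`c = 1`, `hDegreeOrbitGe_dual_two`) and ✗ for `p ≥ 3`
  (`not_hDegreeOrbitGe_dual_of_three_le`: `c = (log p − log(1 − 1/p))/(2·log p) < 1`).
* **2P** (v2 APPEND §5; abc-iut-rp-m4's pinned two-place bed `TwoPlace.twoSetting p c depth`): `negLogThetaAt = −2c = −|log q|`, `HDegreeOrbitGe` ✓
  (`c = 1`, `hDegreeOrbitGe_twoPlace`), `S` ✗ — `twoPlace_profile`, the two-place twin of `sphere_two_profile`.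
PROFILE of record after this file (beds CM · LS(d) · P♮ · U · FLIP · EXP(e) · SPH(p) · DUAL(p) · ∀-honest · REAL; 2P: I17b ✓, I17b′ ✓): RP-I17b ✓ · ✓ iff d ≤ 2 · ✓ ·
✓ · ✓ · ✓ iff 0 < Σe · ✓ · ✓ · ✓ (c = 1/PN(j²)) · ✓ (c = 1/PN(j²)); RP-I17b′ ✗ · ✓ iff d = 2 · ✓ · ✗ · ✗ · ✓ iff 5 ≤ Σe · ✓ (all p) · ✓ iff p = 2 ·
✗ · ✗. RP-I16a/I16b/I17a: ✓ on every typed-Thm-3.11 bed with pins, by theorem (`CandInternal40.hAlienColumn_of_thm311_of_pinned3`,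
`hInd3Origin_of_thm311`, `CandInternal41.hUnitCoric_of_thm311`), instanced here at SPH(2) only.

HONEST SCOPE: one-place `l⋇ = 2` toy beds of the tree; evaluating a typed hypothesis on model data grades no author and asserts nothing
about print. TAKES NO SIDE on [IUTchIII] Cor. 3.12. [cite: ScholzeStix2018, §2.2 pp. 9–10] [claim: Mochizuki2012, status: disputed]
-/

noncomputable section

namespace Summit.ABC.IUTFork.Repair.CandInternal41Beds

open Thm311 Cor312 Cor312Vol Literature.IUT.LogThetaLattice Cor312.Checks Cor312.IdentifiedNonVacuity
open CandInternal41

/-! ## 0. A toy-index evaluation lemma: `negLogThetaAt` of a label-constant column -/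

/-- Over the one-place toy index, if every `𝔽_l^⋇`-label's column-`m` Kummer image has log-volume `a`, then `negLogThetaAt = a`
(procession normalisation of a constant). [folklore] -/
theorem negLogThetaAt_toy_const (S : LatticeSituation Checks.toyIndex) (P : Cor312.Setting S.toSituation) (m : ℤ) (a : ℝ)
    (h : ∀ (i : Fin Checks.toyIndex.lstar) (vQ : Checks.toyIndex.VQ), (S.D P.n).logvol (Setting.labelSucc i) vQ (P.thetaRegion m (Setting.labelSucc i) vQ) = a) :
    negLogThetaAt S P m = a := by
  unfold negLogThetaAt
  have hf : (fun i : Fin Checks.toyIndex.lstar => ∑ᶠ vQ : Checks.toyIndex.VQ,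
      (S.D P.n).logvol (Setting.labelSucc i) vQ (P.thetaRegion m (Setting.labelSucc i) vQ)) = fun _ => a := by
    funext i
    rw [finsum_unique]
    exact h i _
  rw [hf]
  exact processionNormalized_const (by decide) _

/-- Over the toy index every `v_ℚ`-support is finite: `ThetaAtFinite` holds on every toy bed. [folklore] -/
theorem thetaAtFinite_toyIndex (S : LatticeSituation Checks.toyIndex) (P : Cor312.Setting S.toSituation) (m : ℤ) : ThetaAtFinite S P m :=
  fun _ => Set.toFinite _

/-- `HDegreeOrbitGe` from a constant `negLogThetaAt = a` with `negLogQ = c·a`, `1 ≤ c`. [folklore] -/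
theorem hDegreeOrbitGe_of_const (S : LatticeSituation Checks.toyIndex) (P : Cor312.Setting S.toSituation) (a c : ℝ) (hc : 1 ≤ c)
    (ha : ∀ m : ℤ, negLogThetaAt S P m = a) (hq : P.negLogQ = c * a) : HDegreeOrbitGe S P :=
  ⟨thetaAtFinite_toyIndex S P, c, hc, fun m => by rw [ha m, hq]⟩

/-- `HDegreeOrbit` from a constant `negLogThetaAt = a` with `negLogQ = c·a`, `0 < c`. [folklore] -/
theorem hDegreeOrbit_of_const (S : LatticeSituation Checks.toyIndex) (P : Cor312.Setting S.toSituation) (a c : ℝ) (hc : 0 < c)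
    (ha : ∀ m : ℤ, negLogThetaAt S P m = a) (hq : P.negLogQ = c * a) : HDegreeOrbit S P :=
  ⟨thetaAtFinite_toyIndex S P, c, hc, fun m => by rw [ha m, hq]⟩

/-- Conversely, with a constant NONZERO `negLogThetaAt = a`, `HDegreeOrbitGe` forces `negLogQ = c·a` for some `c ≥ 1`. [folklore] -/
theorem exists_ge_one_of_hDegreeOrbitGe (S : LatticeSituation Checks.toyIndex) (P : Cor312.Setting S.toSituation) (a : ℝ)
    (ha : ∀ m : ℤ, negLogThetaAt S P m = a) (h : HDegreeOrbitGe S P) : ∃ c : ℝ, 1 ≤ c ∧ P.negLogQ = c * a := by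
  obtain ⟨_, c, hc, hcm⟩ := h
  exact ⟨c, hc, by rw [hcm 0, ha 0]⟩

variable (p : ℕ) [hp : Fact p.Prime]

/-- `0 < log p`. [folklore] -/
theorem log_p_pos' : 0 < Real.log p := Real.log_pos (by exact_mod_cast hp.out.one_lt)

/-- `−log p ≤ log(1 − 1/p)` for a prime `p` (i.e. `1/p ≤ 1 − 1/p`, `p ≥ 2`). [folklore] -/
theorem neg_log_le_log_one_sub_inv : -Real.log p ≤ Real.log (1 - 1 / (p : ℝ)) := by
  have hp2 : (2 : ℝ) ≤ p := by exact_mod_cast hp.out.two_le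
  have hp0 : (0 : ℝ) < p := by linarith
  rw [← Real.log_inv]
  refine Real.log_le_log (inv_pos.2 hp0) ?_
  rw [one_div, le_sub_iff_add_le, ← two_mul, ← div_eq_mul_inv, div_le_one hp0]
  exact hp2

omit hp in
/-- For `p ≥ 3`: `−log p < log(1 − 1/p)` strictly (`1/p < 1 − 1/p`). [folklore] -/
theorem neg_log_lt_log_one_sub_inv (h3 : 3 ≤ p) : -Real.log p < Real.log (1 - 1 / (p : ℝ)) := by
  have hp3 : (3 : ℝ) ≤ p := by exact_mod_cast h3
  have hp0 : (0 : ℝ) < p := by linarith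
  rw [← Real.log_inv]
  refine Real.log_lt_log (inv_pos.2 hp0) ?_
  rw [one_div, lt_sub_iff_add_lt, ← two_mul, ← div_eq_mul_inv, div_lt_one hp0]
  linarith

/-! ## 1. Bed U (the unit countermodel `uSetting p`): same numerics as CM -/

section U

open Cor312Vol.UnitWitness Cor312Vol.NaiveWitness Cor312Vol.PinnedWitness

/-- U: `negLogThetaAt = −(5/2)·log p` (`(μ(B_1) + μ(B_4))/2`, images `B_{j²}`). [folklore] -/
theorem negLogThetaAt_unit (m : ℤ) : negLogThetaAt (uFull p).toLatticeSituation (uSetting p) m = -(5 / 2) * Real.log p := by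
  unfold negLogThetaAt
  have hf : (fun i : Fin Checks.toyIndex.lstar => ∑ᶠ vQ : Checks.toyIndex.VQ, ((uFull p).toLatticeSituation.D (uSetting p).n).logvol
      (Setting.labelSucc i) vQ ((uSetting p).thetaRegion m (Setting.labelSucc i) vQ)) = fun i => -(jsq (Setting.labelSucc i) : ℝ) * Real.log p := by
    funext i
    rw [finsum_unique, uSetting_thetaRegion]
    exact uLine_logvol_uBall p _ _ _ _
  rw [hf]
  have h1 : jsq (Setting.labelSucc (T := Checks.toyIndex) ⟨0, by decide⟩) = 1 := by decide
  have h2 : jsq (Setting.labelSucc (T := Checks.toyIndex) ⟨1, by decide⟩) = 4 := by decide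
  show (∑ i : Fin 2, -(jsq (Setting.labelSucc i) : ℝ) * Real.log p) / ((2 : ℕ) : ℝ) = _
  rw [Fin.sum_univ_two]
  change (-(jsq (Setting.labelSucc (T := Checks.toyIndex) ⟨0, by decide⟩) : ℝ) * Real.log p +
    -(jsq (Setting.labelSucc (T := Checks.toyIndex) ⟨1, by decide⟩) : ℝ) * Real.log p) / ((2 : ℕ) : ℝ) = _
  rw [h1, h2]
  push_cast
  ring

/-- **U: `HDegreeOrbit` HOLDS with `c = 2/5`.** [folklore] -/
theorem hDegreeOrbit_unit : HDegreeOrbit (uFull p).toLatticeSituation (uSetting p) :=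
  hDegreeOrbit_of_const _ _ (-(5 / 2) * Real.log p) (2 / 5) (by norm_num) (negLogThetaAt_unit p)
    (by rw [uSetting_negLogQ]; ring)

/-- **U: `HDegreeOrbitGe` FAILS** (`c = 2/5 < 1` is forced). [folklore] -/
theorem not_hDegreeOrbitGe_unit : ¬ HDegreeOrbitGe (uFull p).toLatticeSituation (uSetting p) := fun h => by
  obtain ⟨c, hc, hq⟩ := exists_ge_one_of_hDegreeOrbitGe _ _ _ (negLogThetaAt_unit p) h
  rw [uSetting_negLogQ] at hq
  have := log_p_pos' p
  nlinarith

end U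

/-! ## 2. Bed P♮ (the natural model `natSetting`, where `S` holds): `c = 1` -/

section Nat

open Cor312Vol.NaturalWitness Cor312Vol.NaiveWitness Cor312Vol.PinnedWitness

/-- P♮: `negLogThetaAt = −2` (the Θ-image at a label of `𝔽_l^⋇` is `halfPos`, volume `−2`). [folklore] -/
theorem negLogThetaAt_nat (m : ℤ) : negLogThetaAt natFull.toLatticeSituation natSetting m = -2 :=
  negLogThetaAt_toy_const _ _ m _ fun i vQ => by
    show natVol _ _ (natSetting.thetaRegion m (Setting.labelSucc i) vQ) = _
    rw [natSetting_thetaRegion, thetaRegionNat_one_of_ne_zero (Setting.labelSucc_ne_zero i)]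
    exact (natVol_values _ _).2.1

/-- **P♮: `HDegreeOrbitGe` HOLDS with `c = 1`** (`−|log q| = −2 = negLogThetaAt`). [folklore] -/
theorem hDegreeOrbitGe_nat : HDegreeOrbitGe natFull.toLatticeSituation natSetting :=
  hDegreeOrbitGe_of_const _ _ (-2) 1 le_rfl negLogThetaAt_nat (by rw [natSetting_negLogQ]; ring)

/-- P♮: `HDegreeOrbit` HOLDS. [folklore] -/
theorem hDegreeOrbit_nat : HDegreeOrbit natFull.toLatticeSituation natSetting := hDegreeOrbit_of_ge _ _ hDegreeOrbitGe_nat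

end Nat

/-! ## 3. Bed SPH (the sphere setting `sphereSetting p`): `HDegreeOrbitGe` holds for every prime, `S` fails -/

section Sphere

open Cor312Vol.NaiveWitness

/-- SPH: `negLogThetaAt = μ(S_1) = −log p + log(1 − 1/p)`. [folklore] -/
theorem negLogThetaAt_sphere (m : ℤ) :
    negLogThetaAt (sphereFull p).toLatticeSituation (sphereSetting p) m = -Real.log p + Real.log (1 - 1 / (p : ℝ)) :=
  negLogThetaAt_toy_const _ _ m _ fun i vQ => by
    show sphereVol p _ _ ((sphereSetting p).thetaRegion m (Setting.labelSucc i) vQ) = _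
    rw [sphereSetting_thetaRegion, sphereVol_pSphere]
    push_cast; ring

/-- SPH: `negLogThetaAt < 0`. [folklore] -/
theorem negLogThetaAt_sphere_neg (m : ℤ) : negLogThetaAt (sphereFull p).toLatticeSituation (sphereSetting p) m < 0 := by
  rw [negLogThetaAt_sphere]
  have := log_p_pos' p
  have := CandMochizuki6Separation.log_one_sub_inv_nonpos p
  linarith

/-- **SPH: `HDegreeOrbitGe` HOLDS for every prime `p`**, with `c = −2·log p / (−log p + log(1 − 1/p)) ≥ 1`. [folklore] -/
theorem hDegreeOrbitGe_sphere : HDegreeOrbitGe (sphereFull p).toLatticeSituation (sphereSetting p) := by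
  set a : ℝ := -Real.log p + Real.log (1 - 1 / (p : ℝ)) with ha_def
  have ha : a < 0 := by have h := negLogThetaAt_sphere_neg p 0; rwa [negLogThetaAt_sphere] at h
  refine hDegreeOrbitGe_of_const _ _ a ((-2 * Real.log p) / a) ?_ (negLogThetaAt_sphere p) ?_
  · rw [le_div_iff_of_neg ha, one_mul, ha_def]
    have := neg_log_le_log_one_sub_inv p
    linarith
  · rw [sphereSetting_negLogQ, div_mul_cancel₀ _ ha.ne]

/-- SPH: `HDegreeOrbit` HOLDS. [folklore] -/
theorem hDegreeOrbit_sphere : HDegreeOrbit (sphereFull p).toLatticeSituation (sphereSetting p) :=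
  hDegreeOrbit_of_ge _ _ (hDegreeOrbitGe_sphere p)

/-- SPH(2): the orbit parameter is exactly `1` (`−|log q| = −2·log 2 = μ(S_1)`). [folklore] -/
theorem negLogThetaAt_sphere_two (m : ℤ) :
    negLogThetaAt (sphereFull 2).toLatticeSituation (sphereSetting 2) m = (sphereSetting 2).negLogQ := by
  haveI : Fact (Nat.Prime 2) := ⟨Nat.prime_two⟩
  rw [negLogThetaAt_sphere, sphereSetting_negLogQ]
  have h : Real.log (1 - 1 / ((2 : ℕ) : ℝ)) = -Real.log 2 := by
    rw [show (1 - 1 / ((2 : ℕ) : ℝ)) = (2 : ℝ)⁻¹ by norm_num, Real.log_inv]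
  rw [h]; push_cast; ring

/-- **SPH(2) PROFILE: all five B0 hypotheses of this seat HOLD, the pins / `BridgeHyps` / `AbsLogQPos` / typed Thm. 3.11 / the Statement hold,
and `S = PilotKummerIndRelated` FAILS.** [folklore] -/
theorem sphere_two_profile :
    (sphereFull 2).Statement ∧ PinnedRegions3 (sphereFull 2).toLatticeSituation (sphereSetting 2) (sphereRho 2) emptyDatum ∧
      BridgeHyps (sphereSetting 2) ∧ (sphereSetting 2).AbsLogQPos ∧
      CandInternal40.HAlienColumn (sphereFull 2).toLatticeSituation (sphereSetting 2) (sphereRho 2) ∧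
      CandInternal40.HInd3Origin (sphereFull 2).toLatticeSituation (sphereSetting 2) ∧
      HUnitCoric (sphereFull 2).toLatticeSituation (sphereSetting 2) ∧
      HDegreeOrbit (sphereFull 2).toLatticeSituation (sphereSetting 2) ∧
      HDegreeOrbitGe (sphereFull 2).toLatticeSituation (sphereSetting 2) ∧
      (sphereSetting 2).Statement ∧
      ¬ PilotKummerIndRelated (sphereFull 2).toLatticeSituation (sphereSetting 2) (sphereRho 2) emptyDatum :=
  haveI : Fact (Nat.Prime 2) := ⟨Nat.prime_two⟩
  ⟨sphereFull_statement 2, sphereSetting_pinnedRegions3 2, sphereSetting_bridgeHyps 2, sphereSetting_absLogQPos 2,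
    CandInternal40.hAlienColumn_of_thm311_of_pinned3 _ _ _ _ (sphereFull_statement 2) (sphereSetting_pinnedRegions3 2),
    CandInternal40.hInd3Origin_of_thm311 _ _ (sphereFull_statement 2),
    hUnitCoric_of_thm311 _ _ (sphereFull_statement 2), hDegreeOrbit_sphere 2, hDegreeOrbitGe_sphere 2,
    (sphereSetting_statement_strict 2).1, sphereSetting_not_pilotKummerIndRelated⟩

/-- **CENSUS FACT: RP-I17b′ `HDegreeOrbitGe` does NOT imply the residual `S`** over the typed interface with the three pins, `BridgeHyps`,
`AbsLogQPos` and typed Thm. 3.11 (witness SPH(2)) — it is a level-S supplier (`CandInternal41.statement_of_hDegreeOrbitGe`) that does not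
factor through level R. [folklore] -/
theorem hDegreeOrbitGe_not_imp_residual :
    ¬ ∀ (T : ThetaIndex) (F : FullSituation T) (P : Cor312.Setting F.toLatticeSituation.toSituation)
        (ρ : (∀ v : T.V, v ∈ T.Vbad → Set (F.L.StarPacket v)) → ∀ (j : T.Label) (vQ : T.VQ), Set (F.L.Packet j vQ))
        (qK : ∀ v : T.V, v ∈ T.Vbad → Set (F.L.StarPacket v)),
        F.Statement → PinnedRegions3 F.toLatticeSituation P ρ qK → BridgeHyps P → P.AbsLogQPos →
          HDegreeOrbitGe F.toLatticeSituation P → PilotKummerIndRelated F.toLatticeSituation P ρ qK := fun h => by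
  obtain ⟨hF, hpin, hB, hq, -, -, -, -, hGe, -, hnot⟩ := sphere_two_profile
  exact hnot (h _ _ _ _ _ hF hpin hB hq hGe)

end Sphere

/-! ## 4. Bed DUAL (`dualSetting p`: Θ-images `B_2`, q-image `S_1`) -/

section Dual

open Cor312Vol.NaiveWitness CandMochizuki6Separation

/-- DUAL: `negLogThetaAt = μ(B_2) = −2·log p`. [folklore] -/
theorem negLogThetaAt_dual (m : ℤ) : negLogThetaAt (sphereFull p).toLatticeSituation (dualSetting p) m = -2 * Real.log p :=
  negLogThetaAt_toy_const _ _ m _ fun i vQ => by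
    show sphereVol p _ _ ((dualSetting p).thetaRegion m (Setting.labelSucc i) vQ) = _
    rw [dual_thetaRegion, sphereVol_pBall]
    push_cast; ring

/-- **DUAL: `HDegreeOrbit` HOLDS for every prime**, `c = (−log p + log(1 − 1/p)) / (−2·log p) > 0`. [folklore] -/
theorem hDegreeOrbit_dual : HDegreeOrbit (sphereFull p).toLatticeSituation (dualSetting p) := by
  have hlp := log_p_pos' p
  have ha : -2 * Real.log p < 0 := by linarith
  have hq : (dualSetting p).negLogQ < 0 := by
    rw [dual_negLogQ]; have := log_one_sub_inv_nonpos p; linarith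
  refine hDegreeOrbit_of_const _ _ (-2 * Real.log p) ((dualSetting p).negLogQ / (-2 * Real.log p)) (div_pos_of_neg_of_neg hq ha)
    (negLogThetaAt_dual p) ?_
  rw [div_mul_cancel₀ _ ha.ne]

/-- **DUAL(2): `HDegreeOrbitGe` HOLDS with `c = 1`** (`−|log q| = μ(S_1) = −2·log 2 = μ(B_2)`). [folklore] -/
theorem hDegreeOrbitGe_dual_two : HDegreeOrbitGe (sphereFull 2).toLatticeSituation (dualSetting 2) :=
  haveI : Fact (Nat.Prime 2) := ⟨Nat.prime_two⟩
  hDegreeOrbitGe_of_const _ _ (-2 * Real.log 2) 1 le_rfl (by simpa using negLogThetaAt_dual 2) (by rw [dual_negLogQ_two, one_mul])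

/-- **DUAL(p), `p ≥ 3`: `HDegreeOrbitGe` FAILS** (`c ≥ 1` would force `−log p + log(1 − 1/p) ≤ −2·log p`, i.e. `log(1 − 1/p) ≤ −log p`,
false for `p ≥ 3`). [folklore] -/
theorem not_hDegreeOrbitGe_dual_of_three_le (h3 : 3 ≤ p) : ¬ HDegreeOrbitGe (sphereFull p).toLatticeSituation (dualSetting p) := fun h => by
  obtain ⟨c, hc, hq⟩ := exists_ge_one_of_hDegreeOrbitGe _ _ _ (negLogThetaAt_dual p) h
  rw [dual_negLogQ] at hq
  have hlp := log_p_pos' p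
  have hlt := neg_log_lt_log_one_sub_inv p h3
  nlinarith

end Dual

/-! ## 5. v2 APPEND (09:5xZ): bed 2P (abc-iut-rp-m4's pinned TWO-PLACE bed `TwoPlace.twoSetting p c depth`, E4) -/

section TwoPlace

open Cor312Vol.TwoPlace Cor312Vol.NaiveProv

variable (c : ℝ)

/-- 2P: `negLogThetaAt = −2c` (at label `j` the two places give `−(j² − 0)c − (j² − 3)c`; average over `j = 1, 2`: `−((−1) + 5)/2·c`)
— EQUAL to `−|log q| = −2c`. [folklore] -/
theorem negLogThetaAt_twoPlace (m : ℤ) : negLogThetaAt (twoFull p c).toLatticeSituation (twoSetting p c depth) m = -2 * c := by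
  unfold negLogThetaAt
  have h : (fun i : Fin twoIndex.lstar => ∑ᶠ vQ : twoIndex.VQ, ((twoFull p c).toLatticeSituation.D (twoSetting p c depth).n).logvol
      (Setting.labelSucc i) vQ ((twoSetting p c depth).thetaRegion m (Setting.labelSucc i) vQ)) =
      fun i : Fin twoIndex.lstar => -((2 * jsq (T := twoIndex) (Setting.labelSucc (T := twoIndex) i) - 3 : ℤ) : ℝ) * c := by
    funext i
    have hv : ∀ vQ : twoIndex.VQ, ((twoFull p c).toLatticeSituation.D (twoSetting p c depth).n).logvol (Setting.labelSucc i) vQ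
        ((twoSetting p c depth).thetaRegion m (Setting.labelSucc i) vQ) = -((jsq (T := twoIndex) (Setting.labelSucc i) - depth vQ : ℤ) : ℝ) * c :=
      fun vQ => by
        show volW p (fun _ => c) _ vQ ((twoSetting p c depth).thetaRegion m (Setting.labelSucc i) vQ) = _
        rw [two_thetaRegion, volW_pBall]
    rw [finsum_eq_sum_of_fintype, Fin.sum_univ_two, hv, hv, depth_val.1, depth_val.2]
    push_cast
    ring
  rw [h, pn_two, two_jsq.1, two_jsq.2]
  push_cast
  ring

/-- **2P: `HDegreeOrbitGe` HOLDS with `c = 1`** (for every weight `c`), although `S` fails there for the pinned reading (rp-m4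
`TwoPlace.two_pinned_not_S`) and the Statement holds with equality. [folklore] -/
theorem hDegreeOrbitGe_twoPlace : HDegreeOrbitGe (twoFull p c).toLatticeSituation (twoSetting p c depth) :=
  ⟨fun _ _ => Set.toFinite _, 1, le_rfl, fun m => by rw [negLogThetaAt_twoPlace, two_negLogQ, one_mul]⟩

/-- 2P: `HDegreeOrbit` HOLDS. [folklore] -/
theorem hDegreeOrbit_twoPlace : HDegreeOrbit (twoFull p c).toLatticeSituation (twoSetting p c depth) :=
  hDegreeOrbit_of_ge _ _ (hDegreeOrbitGe_twoPlace p c)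

/-- **2P PROFILE (pinned, `c = log p`)**: typed Thm. 3.11, the three pins, `BridgeHyps`, `AbsLogQPos`, ALL FIVE d4 hypotheses and the Statement
HOLD; `S` FAILS — the two-place twin of `sphere_two_profile` (second witness of `hDegreeOrbitGe_not_imp_residual`, now with TWO places and ball
carriers). [folklore] -/
theorem twoPlace_profile :
    (twoFull p (Real.log p)).Statement ∧
      PinnedRegions3 (twoFull p (Real.log p)).toLatticeSituation (twoSetting p (Real.log p) depth) (rho2 p depth)
        (qDatum p (0 : twoIndex.V) trivial (Real.log p)) ∧
      BridgeHyps (twoSetting p (Real.log p) depth) ∧ (twoSetting p (Real.log p) depth).AbsLogQPos ∧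
      CandInternal40.HAlienColumn (twoFull p (Real.log p)).toLatticeSituation (twoSetting p (Real.log p) depth) (rho2 p depth) ∧
      CandInternal40.HInd3Origin (twoFull p (Real.log p)).toLatticeSituation (twoSetting p (Real.log p) depth) ∧
      HUnitCoric (twoFull p (Real.log p)).toLatticeSituation (twoSetting p (Real.log p) depth) ∧
      HDegreeOrbit (twoFull p (Real.log p)).toLatticeSituation (twoSetting p (Real.log p) depth) ∧
      HDegreeOrbitGe (twoFull p (Real.log p)).toLatticeSituation (twoSetting p (Real.log p) depth) ∧
      Summit.ABC.IUTFork.Cor312.Setting.Statement (twoSetting p (Real.log p) depth) ∧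
      ¬ PilotKummerIndRelated (twoFull p (Real.log p)).toLatticeSituation (twoSetting p (Real.log p) depth) (rho2 p depth)
        (qDatum p (0 : twoIndex.V) trivial (Real.log p)) := by
  obtain ⟨hF, hB, hq, hpin, hS, -, -, -, -, hnot⟩ := two_place_pinned_witness p
  exact ⟨hF, hpin, hB, hq, CandInternal40.hAlienColumn_of_thm311_of_pinned3 _ _ _ _ hF hpin, CandInternal40.hInd3Origin_of_thm311 _ _ hF,
    hUnitCoric_of_thm311 _ _ hF, hDegreeOrbit_twoPlace p _, hDegreeOrbitGe_twoPlace p _, hS, hnot⟩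

end TwoPlace

end Summit.ABC.IUTFork.Repair.CandInternal41Beds

end
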